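import Summits.QuantumFields.BalabanUV.T4Continuum.Support.NE9AugmentedPencil
import Summits.QuantumFields.BalabanUV.T4Continuum.Support.NE9HoloFamilyCoupledEnd
import Summits.QuantumFields.BalabanUV.T4Continuum.Support.NE9HoloFamilyPotentialKPG
import Summits.QuantumFields.BalabanUV.T4Continuum.Support.NE9TablePolydiscSPEnd

/-!
# NE9AugmentedPencilEnd — ROUTE R1′♯-AUG, PART 2 (the ENDs): BOTH co-leads' record-shape ENDs with the coupling half (L) DERIVED from the
# AUGMENTED pencil of PART 1 `NE9AugmentedPencil` (ONE letter `hKPA` on `Pot × ℂ`; no `TwoPointKP`, no KP(2m), no `hCup`, no `hclip`) — §4 route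
# R4♯-SP's END re-cut TWO-RADII (pencil room on `R₀` = the rate `θ`; inner room on `s₀`, letter `θ₀`, = the occupation; the desk's A-v11-1 ∕ the
# owner's `NE9HoloFamilyTwoRadiiEnd` pattern), §5 route R3′'s END (size induction, leaf-06 p258374) VERBATIM, §5♯ the same at the table-polydisc
# Schwarz–Pick rate (leaf-06 p260700 §3c), §6 the R4 junction at `ΨOf`; ℓ = `2·B∕(R₀ − s₀)·max c̄d q̄T` throughout

Cell `pub-balaban`, T4-DAG §6 row NE9; NE9 crux team (coordinator ruling «YM REDIRECT» e34b3e0c (2)), leaf lineage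
`b2b-balaban-t4-ne9-formalise-leaf-06` generation 40; route R1′♯-AUG «the augmented pencil» of `t4/ROUTES-NE9.md` v9∕v10 §L1.1 serving the two
co-leads R4 (rank 1) and R3′ (rank 2; listed first since T19) as an OPTIONAL (L)-supplier — NOT a fifth route (idea-1's label; desk F-v11-3).
ENGINE AND AUTHORSHIP of §4 (before the re-cut), §5, §6: the crux-ideation seat `b2b-balaban-t4-ne9-idea-1` generation 9, HOME scratch
`t4/ideate/NE9/lens1-NE9AugmentedPencil.lean` sha16 398adf3ef5349051 §4–§6 (rc 0 by its author and by the pricing desk g11); FILED by leaf-06 on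
idea-1's OFFER O-v9-AUG ∕ ROUTES v10 TOP-TWO HANDOFF after the row OWNER `t4-ne9-p1` g62 declined it for his lineage ((W6)); journal INTENT 3
l.30393.  LEAF-06's CHANGES: (i) §4∕§6 RE-CUT TWO-RADII — the scratch roomed the R4 END once, on `s₀` (`ωh * s₀ + τbar * (2 * B + pbar) ≤ θ * s₀`,
rate `θ(s₀)` — the «one-radius trap» of PRICING-NE9 v11 F-v11-1); here the pencil room `hroom : ωh * R₀ + τbar * (2 * B + pbar) ≤ θ * R₀` fixes the
RATE `θ = θ(R₀)` (E132 §5) and the inner room `hroom₀ : ωh * s₀ + τbar * (2 * B + pbar) ≤ θ₀ * s₀`, `θ₀ < 1`, feeds ONLY the occupation behind (L)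
(E131 §1) — letters and order as in the owner's `NE9HoloFamilyTwoRadiiEnd.ne9_and_fadingMemory_of_potentialKPG_coupling_twoRadii_SP_vac` (p261261),
whose binder list §4 equals after the substitution {`hKP`, `hkp2`, `hclip0`, `hclipb`, `hCup`, `hqT0`} ↦ {`hKPA`, `hread`, `hdisp0`, `hdispW`,
`hdispL`, `hcd0`, `hcdb`}; (ii) §5♯ NEW — R3′'s END with the table half at the SP rate `ω + 2·B·R₀∕(R₀² − s₀²)·τ̄` (leaf-06's
`NE9TablePolydiscSPEnd` §3c by name; `+ hs₀`), the coupling half keeping PART 1's stadium constant (PART 1 §2 is a LINE estimate in the coupling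
coordinate; an SP constant ACROSS the coupling would need M1 on `ℓ^∞ × ℂ` — not in the tree, not claimed).

PRICING (desk's letters, F-v11-3 ∕ T22): ℓ_AUG = `2·B∕(R₀ − s₀)·max(c̄d, q̄T)` vs the `hCup` road's `2·clipbar·B + 2·B∕(R₀ − s₀)·q̄T` — «≤ ×2 on ℓ's
coupling part», PREFACTOR ONLY; rates unchanged (§4: `θ(R₀)` = 15∕26 ∣ 0.7830 at print's box with the prefactor `1∕(1−θ²)`; §5: `ω + 2Bτ̄∕(R₀−s₀)`;
§5♯: `ω + 2B·R₀·τ̄∕(R₀²−s₀²)`); no life-region, rank or KEEP∕KILL move; wall item W2's coupling two-point ↦ W2-AUG (the bidisc scope clause).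

HONEST FRAMING (T4-DAG PAGE 1).  Rung (B)+1 of the FINITE-VOLUME T⁴ programme — NOT infinite volume, NOT a mass gap, NOT the Clay problem.  NE9
(`T4OutputRate.NE9` ∧ `FadingMemory`) is a cell NEW ESTIMATE, NOT PRINTED in [I] = [Balaban1987RG1] (CMP **109**), [II] = [Balaban1988RG2Cluster]
(CMP **116**), NOT PROVED for Bałaban's E^{(j)}: every END below is «NE9 ⇐ the named binders»; displayed Bałaban-side inputs: the AUGMENTED pencil
`hKPA` on `R₀` at every background incl. `U₀` (one more (R-0)-type scope clause, the desk's W2-AUG — EXACTLY AS UNPRINTED as `hCup`), the reading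
identity `hread`, the window's displacement moduli, `hdec`, `hpin`, `hTcup` (TYPE [II] (1.33)–(1.36)), `hexplZ`∕`hp₀` (TYPE [I] (2.14) ∕ [II]
(2.41)) or the size block, structural binders, the ROOM(S); W1 = the model O-NE9-1 untouched (PARKED under FREEZE (0)); the displays `z`, `S`,
`θ`, `θ₀` are letters of an instancer that does not exist; row NE9 WALLED ON A MODEL; spine PROVED 0∕9.  An instance SUBSTITUTION inside
CONDITIONAL ENDs is not progress on the estimate itself (desk: rate-inert, rank-neutral, T22).  HONEST DEPENDENCY (cell line, verbatim):
continuum YM on T⁴ ⇐ BetaPertH ∧ nine spine estimates (0/9 proved); BetaPertH ⇐ (D1) ∧ (D4) ∧ CAP+tail; G-an2-4 gates asym, D1 and NE2/3/4.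
`FlowStep.BetaPertH`, (B), (B^μ) do not occur; [I]∕[II] for TYPES only (ABSOLUTE RULE).

CONTENT ([folklore]; 0 def, 0 Prop-valued definition, 0 sorry):
* §4 **`ne9_and_fadingMemory_of_augmentedPencil_twoRadii_SP_vac`** — R4♯-SP's END: E132 §5 (pencil room on `R₀`, rate `θ`) with `hlast :=` PART 1 §3,
  occupation by E131 §1 `termSize_and_occupation_of_room` at the inner room (`s₀`, `θ₀`) on E132 §4's slice clauses restricted to `ball 0 s₀`.
* §5 **`ne9_and_fadingMemory_of_augmentedPencil_vacSub_sizeInduction`** (idea-1 VERBATIM) — R3′'s END: leaf-06's p258374 §3 with `hlast :=` PART 1 §3,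
  occupation by p258374 §2 (size induction on KP(m)) ⊢ `TermSize ∧ NE9 ∧ FadingMemory`, rate `ω + 2·B∕(R₀ − s₀)·τ̄`.
* §5♯ **`ne9_and_fadingMemory_of_augmentedPencil_vacSub_sizeInduction_SP`** (leaf-06) — §5 at `Pot := ℓ^∞(A;ℂ)`, `+ hs₀`, into p260700 §3c ⊢ rate
  `ω + 2·B·R₀∕(R₀² − s₀²)·τ̄`.
* §6 **`ne9_and_fadingMemory_of_augmentedPencil_twoRadii_psiOf_SP`** — §4 at `Ψ := NE9EndApplied.ΨOf` (`psiOf_eq_vac`, `rfl`).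
DISGUISE TEST: composition by name over PART 1, E131 §1, E132 §4∕§5, p258374, p260700; no history beyond the displayed binders; nothing of
Bałaban's asserted; no named fact.  WHAT THIS DOES NOT DO: touches no activity, species or estimate of the series; moves no rate; the instance
burden is SUBSTITUTED (W2-AUG), not removed; E131∕E132∕p258374∕p260700∕p261261 are imported or paralleled BY NAME and NOT modified.

References (TYPES ∕ loci only): [Balaban1987RG1] T. Bałaban, CMP **109** (1987) 249–301 — (0.23) p. 256, p. 263 (1.18), (2.12)–(2.14) p. 268;
[Balaban1988RG2Cluster] T. Bałaban, CMP **116** (1988) 1–22 — (1.33)–(1.36) p. 9, (2.14)–(2.15) p. 15, Lemma 3 (2.38) p. 20, (2.40)–(2.41) p. 21;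
[KoteckyPreiss1986] CMP **103** (1986) 491–498; [FV1980] T. Franzoni, E. Vesentini, North-Holland Math. Studies 40 (1980), ch. V §5.
Summits-side NEW work (LEAN PLACEMENT RULE); modifies nothing; 0 sorry.  Value = T22's station (an alternative (L)-supplier docked in both
co-leads' record ENDs, the R4 one in the two-radii cut), NOT summit progress.
-/

noncomputable section

namespace Summit.QuantumFields.BalabanUV.T4Continuum.NE9AugmentedPencilEnd

open Metric Set
open scoped BigOperators ENNReal
open Literature.Probability.LatticeModels
open Literature.MathematicalPhysics.QuantumFieldTheory.Balaban1983to89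
open Literature.MathematicalPhysics.QuantumFieldTheory.Balaban1983to89.T4OutputRate
open Literature.MathematicalPhysics.QuantumFieldTheory.Balaban1983to89.T4ActivityLipschitz
open Literature.MathematicalPhysics.QuantumFieldTheory.Balaban1983to89.T4HistoryLipschitzRecursion
open Literature.MathematicalPhysics.QuantumFieldTheory.Balaban1983to89.T4HistoryLipschitzOuter
open Literature.MathematicalPhysics.QuantumFieldTheory.Balaban1983to89.T4HistoryLipschitzActivity
open Literature.MathematicalPhysics.QuantumFieldTheory.Balaban1983to89.T4HistoryLipschitzSegment
open Literature.MathematicalPhysics.QuantumFieldTheory.Balaban1983to89.T4HistoryLipschitzActivity (ClusterGeom)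
open Summit.QuantumFields.BalabanUV.T4Continuum.NE9FutureProfileStep
open Summit.QuantumFields.BalabanUV.T4Continuum.NE9ChannelRealLinear
open Summit.QuantumFields.BalabanUV.T4Continuum.NE9ChannelReadingSharp (norm_RdAmb_le_geometric_sharp)
open Summit.QuantumFields.BalabanUV.T4Continuum.NE9TableReading
open Summit.QuantumFields.BalabanUV.T4Continuum.NE9FutureProfileRecordPrelim (τ_geom)
open Summit.QuantumFields.BalabanUV.T4Continuum.NE9FutureProfileReal (isSelfAdjoint_reading)
open Summit.QuantumFields.BalabanUV.T4Continuum.NE9HoloFamilyOfPencil (exists_star_clm_lp)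
open Summit.QuantumFields.BalabanUV.T4Continuum.NE9HoloFamilyVacuumSubtracted (psiOf_eq_vac)
open Summit.QuantumFields.BalabanUV.T4Continuum.NE9HoloFamilyPotentialKPG (vacSlice_clauses_of_potentialKPG
  ne9_and_fadingMemory_of_potentialKPG_SP_vac)
open Summit.QuantumFields.BalabanUV.T4Continuum.NE9HoloFamilyCoupledEnd (termSize_and_occupation_of_room)
open Summit.QuantumFields.BalabanUV.T4Continuum.NE9PencilSizeInduction
open Summit.QuantumFields.BalabanUV.T4Continuum.NE9TablePolydiscSPEnd (ne9_and_fadingMemory_of_potentialKPG_vacSub_sizeInduction_SP)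
open Summit.QuantumFields.BalabanUV.T4Continuum.NE9AugmentedPencil

/-! ## §4 ROUTE R4♯-SP's END OF RECORD WITH BOTH HALVES ON KP(m) LETTERS — augmented pencil, TWO RADII (pencil room on `R₀` = the rate `θ`;
inner room on `s₀`, letter `θ₀`, = the occupation the coupling half reads) -/

section RoomR4

variable {C : Carriers} {Bg : Type} {ι : Type} [Nonempty ι] {E : Functional C Bg} {W : Set (ℕ → ℝ)}
  {Adm : Set (Bg → C.Dom → ℝ)} {T : ℕ → (ℕ → ℝ) → (Bg → C.Dom → ℝ) → ι → ℝ} {Ψ : ℕ → ℝ → (ι → ℝ) → Bg → C.Dom → ℝ}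
  {κ : ℝ} {wt : ℕ → ι → ℝ} {τ : ℕ → ℕ → ℝ} {τbar ω ωh : ℝ}

/-- [folklore] **ROUTE R4♯-SP's END OF RECORD, TABLE HALF `PotentialKPG` (E132 §5, pencil room on `R₀`, rate `θ`) AND COUPLING HALF FROM
THE AUGMENTED PENCIL (PART 1 §3, occupation by the INNER room on `s₀` with its own letter `θ₀ < 1`, E131 §1) — TWO RADII.**  idea-1's scratch §4
roomed BOTH on `s₀` (one radius, rate `θ(s₀)`); this is the re-cut the desk's A-v11-1 asks for and the owner's `NE9HoloFamilyTwoRadiiEnd` (p261261)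
realises on the `hCup` road: binders = E134 §2's structural list, `hdec`, `hpin` (budget `B`), the record's shape `hΨv`, `hexplZ`∕`hp₀`, the
channel's coupling modulus `hTcup`, `hqTb` (`hqT0` IDLE: the max needs no sign), `0 < s₀ < R₀`, `0 < θ < 1`, `θ₀ < 1`, the PENCIL room
`ω̂·R₀ + τ̄·(2B + p̄₀) ≤ θ·R₀` and the INNER room `ω̂·s₀ + τ̄·(2B + p̄₀) ≤ θ₀·s₀` — with E134's pencil letters `hKP`∕`hkp2` AND its coupling
two-point letters `hCup`∕`hclip0`∕`hclipb` REPLACED by the augmented pencil `hKPA : PotentialKPG W actA m a d R₀` on `ℓ^∞(ι;ℂ) × ℂ`, the reading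
identity `hread` (`hdisp0`), the window's displacement moduli `hdispW`∕`hdispL` and `0 ≤ cd k ≤ c̄d`.  NO `TwoPointKP`, NO KP(2m), NO occupation
hypothesis.  Conclusion: `NE9 ∧ FadingMemory` with `prodModuli ((1∕(1−θ²))·ℓ) (fun _ => θ)`, `ℓ = 2·B∕(R₀ − s₀)·max c̄d q̄T`.  Proof: PART 1 §1 ⇒
`PotentialKPG W act`; E132 §4's slice clauses restricted to `ball 0 s₀` ⇒ occupation by E131 §1 at the inner room; PART 1 §3 ⇒ (L); E132 §5 at the
pencil room.  «NE9 ⇐ the named binders».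
[cite: Balaban1987RG1, (2.13)-(2.14) p.268 and p.263 (1.18); Balaban1988RG2Cluster, (1.33)-(1.36) p.9, (2.14)-(2.15) p.15, Lemma 3 (2.38) p.20, (2.40)-(2.41) p.21; FV1980, ch.V §5] -/
theorem ne9_and_fadingMemory_of_augmentedPencil_twoRadii_SP_vac (G : ClusterGeom C)
    (h0 : ∀ g ∈ W, ∀ (U : Bg) (X : C.Dom), C.scale X = 0 → E g U X = 0)
    (hAdm : AdmissibleTerms E W Adm) (hres : AdmRestrict Adm) (hadd : ChannelAdditive Adm T) (hloc : ChannelLocal Adm T)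
    (hstep : ChannelSizeAtStepNN Adm T κ wt τ) (hfac : Factorises E W T Ψ)
    (hsmul : ∀ (c : ℝ), ∀ H ∈ Adm, c • H ∈ Adm) (hne : Adm.Nonempty) (hwt : ∀ m y, 0 < wt m y)
    (hτ : ∀ k j, j ≤ k → 0 ≤ τ k j ∧ τ k j ≤ τbar * ω ^ (k - j)) (hτbar : 0 < τbar) (hω : 0 ≤ ω) (hωh : 0 < ωh)
    (hωωh : ω ≤ ωh)
    {act : ℕ → ℝ → Bg → lp (fun _ : ι => ℂ) ∞ → G.P → ℂ} {actA : ℕ → ℝ → Bg → lp (fun _ : ι => ℂ) ∞ × ℂ → G.P → ℂ}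
    {m : ℕ → ℝ → Bg → G.P → ℝ} {a d : G.P → ℝ} {δ : C.Dom → ℝ} {U₀ : Bg} {explZ : ℕ → Bg → C.Dom → ℝ} {p₀ qT cd : ℕ → ℝ}
    {disp : ℕ → ℝ → ℝ → ℝ} {R₀ s₀ B pbar θ₀ θ cdbar qTbar : ℝ}
    (hs₀ : 0 < s₀) (hsR : s₀ < R₀) (hB : 0 ≤ B) (hpbar : 0 ≤ pbar) (hθ₀1 : θ₀ < 1) (hθ0 : 0 < θ) (hθ1 : θ < 1)
    (hKPA : G.PotentialKPG W actA m a d R₀)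
    (hread : ∀ g ∈ W, ∀ g' ∈ W, ∀ (k : ℕ) (U : Bg) (X : C.Dom), C.scale X = k + 1 →
      ∀ Q ∈ ball (0 : lp (fun _ : ι => ℂ) ∞) R₀, ∀ γ ∈ G.vol X,
        act k (g' k) U Q γ = actA k (g k) U (Q, ((disp k (g k) (g' k) : ℝ) : ℂ)) γ)
    (hdisp0 : ∀ (k : ℕ) (s : ℝ), disp k s s = 0)
    (hdispW : ∀ g ∈ W, ∀ g' ∈ W, ∀ k : ℕ, |disp k (g k) (g' k)| ≤ s₀)
    (hdispL : ∀ g ∈ W, ∀ g' ∈ W, ∀ k : ℕ, |disp k (g k) (g' k)| ≤ cd k * |g k - g' k|)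
    (hcd0 : ∀ k, 0 ≤ cd k) (hcdb : ∀ k, cd k ≤ cdbar)
    (hdec : G.DecayExtract δ d) (hpin : G.PinBudget a δ (fun _ => B) κ)
    (hΨv : ∀ (k : ℕ) (s : ℝ) (P : ι → ℝ) (U : Bg) (X : C.Dom),
      Ψ k s P U X = (G.newTerm act k s U X (reading (wt k) P)).re - (G.newTerm act k s U₀ X (reading (wt k) P)).re +
        explZ k U X)
    (hexplZ : ∀ (k : ℕ) (U : Bg) (X : C.Dom), C.scale X = k + 1 → |explZ k U X| ≤ Real.exp (-(κ * C.d X)) * p₀ k)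
    (hp₀ : ∀ k, p₀ k ≤ pbar) (hqTb : ∀ k, qT k ≤ qTbar)
    (hTcup : ∀ g ∈ W, ∀ g' ∈ W, ∀ (k : ℕ) (y : ι), |T k g (E g) y - T k g' (E g) y| ≤ wt k y * (qT k * |g k - g' k|))
    (hroom₀ : ωh * s₀ + τbar * (2 * B + pbar) ≤ θ₀ * s₀) (hroom : ωh * R₀ + τbar * (2 * B + pbar) ≤ θ * R₀) :
    NE9 E W κ (prodModuli (1 / (1 - θ ^ 2) * (2 * B / (R₀ - s₀) * max cdbar qTbar)) fun _ => θ) ∧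
      FadingMemory (1 / (1 - θ ^ 2) * (2 * B / (R₀ - s₀) * max cdbar qTbar) / θ) θ
        (prodModuli (1 / (1 - θ ^ 2) * (2 * B / (R₀ - s₀) * max cdbar qTbar)) fun _ => θ) := by
  have hKP := potentialKPG_of_augmented G hKPA hread hdisp0
  obtain ⟨σ, hσa, hσ, hiso⟩ := exists_star_clm_lp (ι := ι)
  have hfixρ : ∀ (k : ℕ) (P : ι → ℝ), σ (reading (wt k) P) = reading (wt k) P := fun k P => by
    rw [hσa]; exact (isSelfAdjoint_reading (wt k) P).star_eq
  obtain ⟨-, hΦb, hreal⟩ := vacSlice_clauses_of_potentialKPG (W := W) (E := E) (T := T) (Ψ := Ψ) (κ := κ) G hσ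
    hiso hfixρ hB hpbar hKP hdec hpin hΨv hexplZ hp₀
  -- the slice clauses restricted from `ball 0 R₀` to `ball 0 s₀`
  have hsub : ball (0 : lp (fun _ : ι => ℂ) ∞) s₀ ⊆ ball 0 R₀ := ball_subset_ball hsR.le
  have hΦb' := fun k g (hg : g ∈ W) => (hΦb k g hg).mono_left hsub
  have hreal' := fun k g (hg : g ∈ W) s (hs : s ∈ W)
    (h : reading (wt k) (T k s (E g)) ∈ ball (0 : lp (fun _ : ι => ℂ) ∞) s₀) => hreal k g hg s hs (hsub h)
  -- occupation of the record's tables in `ball 0 s₀`, from the INNER room at `θ₀` (E131 §1)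
  obtain ⟨-, hocc⟩ := termSize_and_occupation_of_room h0 hAdm hres hadd hloc hstep hfac hsmul hne hwt hτ hω hωh hωωh
    hτbar.le (fun j n s _ => norm_RdAmb_le_geometric_sharp (τ_geom hτ) j n s) hs₀ (by positivity) hθ₀1 hΦb' hreal' hroom₀
  -- the coupling half (§3)
  have hlast := lastCouplingLipschitz_of_augmentedPencil G (fun k => reading (wt k)) U₀ explZ
    (𝒜 := fun _ => ball (0 : lp (fun _ : ι => ℂ) ∞) s₀) hKPA hread hdisp0 hsR (fun _ => ball_subset_closedBall) hdispW hdispL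
    hdec hpin (fun k P P' M h => norm_reading_sub_le (hwt k) h) hΨv hTcup (fun g hg g' hg' k => hocc g hg g' hg' k)
  -- the table half: chain and room on the PENCIL radius `R₀` (E132 §5)
  have hϱ : 0 < R₀ - s₀ := sub_pos.mpr hsR
  have hcoef : 0 ≤ 2 * B / (R₀ - s₀) := by positivity
  have hℓ : 0 ≤ 2 * B / (R₀ - s₀) * max cdbar qTbar :=
    mul_nonneg hcoef ((hcd0 0).trans ((hcdb 0).trans (le_max_left _ _)))
  have hlam : ∀ k, 2 * B / (R₀ - s₀) * max (cd k) (qT k) ≤ 2 * B / (R₀ - s₀) * max cdbar qTbar := fun k =>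
    mul_le_mul_of_nonneg_left (max_le_max (hcdb k) (hqTb k)) hcoef
  exact ne9_and_fadingMemory_of_potentialKPG_SP_vac G h0 hAdm hres hadd hloc hstep hfac hlast hsmul hne hwt hτ hτbar hω hωh
    hωωh (hs₀.trans hsR) hB hpbar hθ0 hθ1 hℓ hKP hdec hpin hΨv hexplZ hp₀ hroom hlam

end RoomR4

/-! ## §5 ROUTE R3′'s END WITH BOTH HALVES ON KP(m) LETTERS: augmented pencil + size induction -/

section SizeR3

variable {C : Carriers} (G : ClusterGeom C) {Bg : Type} {Pot : Type*} [NormedAddCommGroup Pot] [NormedSpace ℂ Pot]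

/-- [folklore] **ROUTE R3′'s RECORD-SHAPE END AT `c_eff = 2`, OCCUPATION FROM THE SIZE INDUCTION, COUPLING HALF FROM THE AUGMENTED
PENCIL** (idea-1 §5 VERBATIM).  Leaf-06's `NE9PencilSizeInduction.ne9_and_fadingMemory_of_potentialKPG_vacSub_sizeInduction` (p258374) with `hKP` and the displayed
coupling half `hlast`∕`hlam`∕`hℓ` REPLACED by `hKPA`, `hread` (`hdisp0`), `hdispW`∕`hdispL`, `hcd0`∕`hcdb`, `hTcup`, `hqTb`: `TermSize E W κ N ∧
NE9 E W κ (prodModuli ℓ (fun _ => ω′)) ∧ FadingMemory (ℓ∕ω′) ω′ …`, `ℓ = 2·B∕(R₀ − s₀)·max c̄d q̄T`, `ω′ = ω + 2·B∕(R₀ − s₀)·τ̄`.  Proof: PART 1 §1; occupation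
by leaf-06's `termSize_of_recursion_vacSub_potentialKPG`; PART 1 §3; leaf-06's END by name.
[cite: Balaban1987RG1, p.263 (1.18) and (2.13)-(2.14) p.268; Balaban1988RG2Cluster, (1.36) p.9, (2.38) p.20, (2.40)-(2.41) p.21] -/
theorem ne9_and_fadingMemory_of_augmentedPencil_vacSub_sizeInduction {ι : Type} {E : Functional C Bg} {W : Set (ℕ → ℝ)}
    {Adm : Set (Bg → C.Dom → ℝ)} {T : ℕ → (ℕ → ℝ) → (Bg → C.Dom → ℝ) → ι → ℝ}
    {Ψ : ℕ → ℝ → (ι → ℝ) → Bg → C.Dom → ℝ} {act : ℕ → ℝ → Bg → Pot → G.P → ℂ}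
    {actA : ℕ → ℝ → Bg → Pot × ℂ → G.P → ℂ} {𝒜 : ℕ → Set Pot}
    {m : ℕ → ℝ → Bg → G.P → ℝ} {a d : G.P → ℝ} {δ : C.Dom → ℝ} {κ s₀ R₀ B τbar ω cdbar qTbar : ℝ} {wt : ℕ → ι → ℝ}
    {τ : ℕ → ℕ → ℝ} {qT cd p₀ N : ℕ → ℝ} {disp : ℕ → ℝ → ℝ → ℝ} (ρ : ℕ → (ι → ℝ) → Pot) (U₀ : Bg)
    (explZ : ℕ → Bg → C.Dom → ℝ)
    (h0 : ScaleZeroFree E W) (hAdm : AdmissibleTerms E W Adm) (hres : AdmRestrict Adm) (hadd : ChannelAdditive Adm T)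
    (hsum : ChannelStepSum Adm T) (hstep : ChannelSizeAtStepNN Adm T κ wt τ) (hfac : Factorises E W T Ψ)
    (hKPA : G.PotentialKPG W actA m a d R₀)
    (hread : ∀ g ∈ W, ∀ g' ∈ W, ∀ (k : ℕ) (U : Bg) (X : C.Dom), C.scale X = k + 1 →
      ∀ Q ∈ ball (0 : Pot) R₀, ∀ γ ∈ G.vol X, act k (g' k) U Q γ = actA k (g k) U (Q, ((disp k (g k) (g' k) : ℝ) : ℂ)) γ)
    (hdisp0 : ∀ (k : ℕ) (s : ℝ), disp k s s = 0)
    (hdispW : ∀ g ∈ W, ∀ g' ∈ W, ∀ k : ℕ, |disp k (g k) (g' k)| ≤ s₀)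
    (hdispL : ∀ g ∈ W, ∀ g' ∈ W, ∀ k : ℕ, |disp k (g k) (g' k)| ≤ cd k * |g k - g' k|)
    (hcd0 : ∀ k, 0 ≤ cd k) (hcdb : ∀ k, cd k ≤ cdbar) (hqTb : ∀ k, qT k ≤ qTbar)
    (hTcup : ∀ g ∈ W, ∀ g' ∈ W, ∀ (k : ℕ) (y : ι), |T k g (E g) y - T k g' (E g) y| ≤ wt k y * (qT k * |g k - g' k|))
    (hdec : G.DecayExtract δ d) (hpin : G.PinBudget a δ (fun _ => B) κ) (hsR : s₀ < R₀)
    (h𝒜 : ∀ k, 𝒜 k ⊆ closedBall (0 : Pot) s₀)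
    (hρ : ∀ (k : ℕ) (P P' : ι → ℝ) (M : ℝ), (∀ y, |P y - P' y| ≤ wt k y * M) → ‖ρ k P - ρ k P'‖ ≤ M)
    (hΨv : ∀ (k : ℕ) (s : ℝ) (P : ι → ℝ) (U : Bg) (X : C.Dom),
      Ψ k s P U X = (G.newTerm act k s U X (ρ k P)).re - (G.newTerm act k s U₀ X (ρ k P)).re + explZ k U X)
    (hexplZ : ∀ (k : ℕ) (U : Bg) (X : C.Dom), C.scale X = k + 1 → |explZ k U X| ≤ Real.exp (-(κ * C.d X)) * p₀ k)
    (hbase : ∀ g ∈ W, ∀ (U : Bg) (X : C.Dom), C.scale X = 0 → |E g U X| ≤ Real.exp (-(κ * C.d X)) * N 0)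
    (hNsucc : ∀ j, p₀ j + 2 * B ≤ N (j + 1)) (hNnn : ∀ j, 0 ≤ N j)
    (hbox : ∀ (k : ℕ) (P : ι → ℝ), (∀ y, |P y| ≤ wt k y * sizeRadius τ N k) → ρ k P ∈ 𝒜 k)
    (hB : 0 ≤ B) (hτbar : 0 ≤ τbar) (hω : 0 ≤ ω) (hpos : 0 < ω + 2 * B / (R₀ - s₀) * τbar)
    (hτ : ∀ k j, j ≤ k → 0 ≤ τ k j ∧ τ k j ≤ τbar * ω ^ (k - j)) :
    TermSize E W κ N ∧
      NE9 E W κ (prodModuli (2 * B / (R₀ - s₀) * max cdbar qTbar) fun _ => ω + 2 * B / (R₀ - s₀) * τbar) ∧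
        FadingMemory (2 * B / (R₀ - s₀) * max cdbar qTbar / (ω + 2 * B / (R₀ - s₀) * τbar))
          (ω + 2 * B / (R₀ - s₀) * τbar)
          (prodModuli (2 * B / (R₀ - s₀) * max cdbar qTbar) fun _ => ω + 2 * B / (R₀ - s₀) * τbar) := by
  have hKP := potentialKPG_of_augmented G hKPA hread hdisp0
  have h𝒜R : ∀ k, 𝒜 k ⊆ ball (0 : Pot) R₀ := fun k Q hQ =>
    mem_ball_zero_iff.2 (lt_of_le_of_lt (mem_closedBall_zero_iff.1 (h𝒜 k hQ)) hsR)
  obtain ⟨-, hocc⟩ := termSize_of_recursion_vacSub_potentialKPG G ρ U₀ explZ hAdm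
    (channelSizeNN_of_perStepNN hres hsum hstep) hfac hKP h𝒜R hdec hpin hΨv hexplZ hbase hNsucc hNnn hbox
  have hlast := lastCouplingLipschitz_of_augmentedPencil G ρ U₀ explZ hKPA hread hdisp0 hsR h𝒜 hdispW hdispL hdec hpin hρ
    hΨv hTcup hocc
  have hϱ : 0 < R₀ - s₀ := sub_pos.mpr hsR
  have hcoef : 0 ≤ 2 * B / (R₀ - s₀) := by positivity
  have hℓ : 0 ≤ 2 * B / (R₀ - s₀) * max cdbar qTbar :=
    mul_nonneg hcoef ((hcd0 0).trans ((hcdb 0).trans (le_max_left _ _)))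
  have hlam : ∀ k, 2 * B / (R₀ - s₀) * max (cd k) (qT k) ≤ 2 * B / (R₀ - s₀) * max cdbar qTbar := fun k =>
    mul_le_mul_of_nonneg_left (max_le_max (hcdb k) (hqTb k)) hcoef
  exact ne9_and_fadingMemory_of_potentialKPG_vacSub_sizeInduction G ρ U₀ explZ h0 hAdm hres hadd hsum hstep hfac hlast hKP
    hdec hpin hsR h𝒜 hρ hΨv hexplZ hbase hNsucc hNnn hbox hℓ hB hτbar hω hpos hlam hτ

end SizeR3

/-! ## §5♯ The same with the TABLE half at the table-polydisc Schwarz–Pick rate (leaf-06's `NE9TablePolydiscSPEnd` §3c, p260700) -/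

section SizeR3SP

variable {C : Carriers} (G : ClusterGeom C) {Bg : Type} {A : Type*}

/-- [folklore] **ROUTE R3′♯-SP's RECORD-SHAPE END, OCCUPATION FROM THE SIZE INDUCTION, COUPLING HALF FROM THE AUGMENTED PENCIL** — §5 with
`Pot := ℓ^∞(A;ℂ)`, `+ hs₀ : 0 ≤ s₀` and leaf-06's table-polydisc END `NE9TablePolydiscSPEnd.ne9_and_fadingMemory_of_potentialKPG_vacSub_sizeInduction_SP`
(p260700 §3c) in place of p258374: rate `ω + 2·B·R₀∕(R₀² − s₀²)·τ̄` (the TABLE half uses the product structure of the `ℓ^∞` ball), while the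
coupling half keeps PART 1 §3's stadium constant `ℓ = 2·B∕(R₀ − s₀)·max c̄d q̄T` (§2 there is a LINE estimate in the coupling coordinate).
[cite: Balaban1987RG1, p.263 (1.18) and (2.13)-(2.14) p.268; Balaban1988RG2Cluster, (1.36) p.9, (2.38) p.20, (2.40)-(2.41) p.21; FV1980, ch.V §5] -/
theorem ne9_and_fadingMemory_of_augmentedPencil_vacSub_sizeInduction_SP {ι : Type} {E : Functional C Bg} {W : Set (ℕ → ℝ)}
    {Adm : Set (Bg → C.Dom → ℝ)} {T : ℕ → (ℕ → ℝ) → (Bg → C.Dom → ℝ) → ι → ℝ}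
    {Ψ : ℕ → ℝ → (ι → ℝ) → Bg → C.Dom → ℝ} {act : ℕ → ℝ → Bg → lp (fun _ : A => ℂ) ∞ → G.P → ℂ}
    {actA : ℕ → ℝ → Bg → lp (fun _ : A => ℂ) ∞ × ℂ → G.P → ℂ} {𝒜 : ℕ → Set (lp (fun _ : A => ℂ) ∞)}
    {m : ℕ → ℝ → Bg → G.P → ℝ} {a d : G.P → ℝ} {δ : C.Dom → ℝ} {κ s₀ R₀ B τbar ω cdbar qTbar : ℝ} {wt : ℕ → ι → ℝ}
    {τ : ℕ → ℕ → ℝ} {qT cd p₀ N : ℕ → ℝ} {disp : ℕ → ℝ → ℝ → ℝ} (ρ : ℕ → (ι → ℝ) → lp (fun _ : A => ℂ) ∞) (U₀ : Bg)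
    (explZ : ℕ → Bg → C.Dom → ℝ)
    (h0 : ScaleZeroFree E W) (hAdm : AdmissibleTerms E W Adm) (hres : AdmRestrict Adm) (hadd : ChannelAdditive Adm T)
    (hsum : ChannelStepSum Adm T) (hstep : ChannelSizeAtStepNN Adm T κ wt τ) (hfac : Factorises E W T Ψ)
    (hKPA : G.PotentialKPG W actA m a d R₀)
    (hread : ∀ g ∈ W, ∀ g' ∈ W, ∀ (k : ℕ) (U : Bg) (X : C.Dom), C.scale X = k + 1 →
      ∀ Q ∈ ball (0 : lp (fun _ : A => ℂ) ∞) R₀, ∀ γ ∈ G.vol X,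
        act k (g' k) U Q γ = actA k (g k) U (Q, ((disp k (g k) (g' k) : ℝ) : ℂ)) γ)
    (hdisp0 : ∀ (k : ℕ) (s : ℝ), disp k s s = 0)
    (hdispW : ∀ g ∈ W, ∀ g' ∈ W, ∀ k : ℕ, |disp k (g k) (g' k)| ≤ s₀)
    (hdispL : ∀ g ∈ W, ∀ g' ∈ W, ∀ k : ℕ, |disp k (g k) (g' k)| ≤ cd k * |g k - g' k|)
    (hcd0 : ∀ k, 0 ≤ cd k) (hcdb : ∀ k, cd k ≤ cdbar) (hqTb : ∀ k, qT k ≤ qTbar)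
    (hTcup : ∀ g ∈ W, ∀ g' ∈ W, ∀ (k : ℕ) (y : ι), |T k g (E g) y - T k g' (E g) y| ≤ wt k y * (qT k * |g k - g' k|))
    (hdec : G.DecayExtract δ d) (hpin : G.PinBudget a δ (fun _ => B) κ) (hsR : s₀ < R₀) (hs₀ : 0 ≤ s₀)
    (h𝒜 : ∀ k, 𝒜 k ⊆ closedBall (0 : lp (fun _ : A => ℂ) ∞) s₀)
    (hρ : ∀ (k : ℕ) (P P' : ι → ℝ) (M : ℝ), (∀ y, |P y - P' y| ≤ wt k y * M) → ‖ρ k P - ρ k P'‖ ≤ M)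
    (hΨv : ∀ (k : ℕ) (s : ℝ) (P : ι → ℝ) (U : Bg) (X : C.Dom),
      Ψ k s P U X = (G.newTerm act k s U X (ρ k P)).re - (G.newTerm act k s U₀ X (ρ k P)).re + explZ k U X)
    (hexplZ : ∀ (k : ℕ) (U : Bg) (X : C.Dom), C.scale X = k + 1 → |explZ k U X| ≤ Real.exp (-(κ * C.d X)) * p₀ k)
    (hbase : ∀ g ∈ W, ∀ (U : Bg) (X : C.Dom), C.scale X = 0 → |E g U X| ≤ Real.exp (-(κ * C.d X)) * N 0)
    (hNsucc : ∀ j, p₀ j + 2 * B ≤ N (j + 1)) (hNnn : ∀ j, 0 ≤ N j)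
    (hbox : ∀ (k : ℕ) (P : ι → ℝ), (∀ y, |P y| ≤ wt k y * sizeRadius τ N k) → ρ k P ∈ 𝒜 k)
    (hB : 0 ≤ B) (hτbar : 0 ≤ τbar) (hω : 0 ≤ ω) (hpos : 0 < ω + 2 * B * R₀ / (R₀ ^ 2 - s₀ ^ 2) * τbar)
    (hτ : ∀ k j, j ≤ k → 0 ≤ τ k j ∧ τ k j ≤ τbar * ω ^ (k - j)) :
    TermSize E W κ N ∧
      NE9 E W κ (prodModuli (2 * B / (R₀ - s₀) * max cdbar qTbar) fun _ => ω + 2 * B * R₀ / (R₀ ^ 2 - s₀ ^ 2) * τbar) ∧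
        FadingMemory (2 * B / (R₀ - s₀) * max cdbar qTbar / (ω + 2 * B * R₀ / (R₀ ^ 2 - s₀ ^ 2) * τbar))
          (ω + 2 * B * R₀ / (R₀ ^ 2 - s₀ ^ 2) * τbar)
          (prodModuli (2 * B / (R₀ - s₀) * max cdbar qTbar) fun _ => ω + 2 * B * R₀ / (R₀ ^ 2 - s₀ ^ 2) * τbar) := by
  have hKP := potentialKPG_of_augmented G hKPA hread hdisp0
  have h𝒜R : ∀ k, 𝒜 k ⊆ ball (0 : lp (fun _ : A => ℂ) ∞) R₀ := fun k Q hQ =>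
    mem_ball_zero_iff.2 (lt_of_le_of_lt (mem_closedBall_zero_iff.1 (h𝒜 k hQ)) hsR)
  obtain ⟨-, hocc⟩ := termSize_of_recursion_vacSub_potentialKPG G ρ U₀ explZ hAdm
    (channelSizeNN_of_perStepNN hres hsum hstep) hfac hKP h𝒜R hdec hpin hΨv hexplZ hbase hNsucc hNnn hbox
  have hlast := lastCouplingLipschitz_of_augmentedPencil G ρ U₀ explZ hKPA hread hdisp0 hsR h𝒜 hdispW hdispL hdec hpin hρ
    hΨv hTcup hocc
  have hϱ : 0 < R₀ - s₀ := sub_pos.mpr hsR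
  have hcoef : 0 ≤ 2 * B / (R₀ - s₀) := by positivity
  have hℓ : 0 ≤ 2 * B / (R₀ - s₀) * max cdbar qTbar :=
    mul_nonneg hcoef ((hcd0 0).trans ((hcdb 0).trans (le_max_left _ _)))
  have hlam : ∀ k, 2 * B / (R₀ - s₀) * max (cd k) (qT k) ≤ 2 * B / (R₀ - s₀) * max cdbar qTbar := fun k =>
    mul_le_mul_of_nonneg_left (max_le_max (hcdb k) (hqTb k)) hcoef
  exact ne9_and_fadingMemory_of_potentialKPG_vacSub_sizeInduction_SP G ρ U₀ explZ h0 hAdm hres hadd hsum hstep hfac hlast hKP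
    hdec hpin hsR hs₀ h𝒜 hρ hΨv hexplZ hbase hNsucc hNnn hbox hℓ hB hτbar hω hpos hlam hτ

end SizeR3SP

/-! ## §6 The R4 junction at the record's own new-term map `NE9EndApplied.ΨOf` (shape by `rfl`), two radii -/

section Record

open Summit.QuantumFields.BalabanUV.T4Continuum.NE9EndApplied
open Summit.QuantumFields.BalabanUV.T4Continuum.NE9ComplexEncoding (doubleCarriers)

variable {C₀ : Carriers} {E : Type} {ι : Type}

/-- [folklore] **ROUTE R4♯-SP's END AT `ΨOf` WITH BOTH HALVES ON KP(m) LETTERS, TWO RADII** — §4 at `Ψ := NE9EndApplied.ΨOf G act wt U₀ explZ`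
(`hΨv` by `psiOf_eq_vac`, `rfl`); compare E131 §5 `ne9_and_fadingMemory_of_pencil_coupling_psiOf_SP` (pencil + `hkp2` + `hCup` + `hclip`)
and E132 §7 `ne9_and_fadingMemory_of_potentialKPG_psiOf_SP` (`hKP` + displayed `hlast`).  Q-v9-explZ: `explZ` carries no coupling slot in
`ΨOf`, on either co-lead. [cite: Balaban1987RG1, (2.12)-(2.14) p.268 and p.263 (1.18); Balaban1988RG2Cluster, (1.33)-(1.36) p.9, Lemma 3 (2.38) p.20, (2.40)-(2.41) p.21] -/
theorem ne9_and_fadingMemory_of_augmentedPencil_twoRadii_psiOf_SP [Nonempty ι] (G : ClusterGeom (doubleCarriers C₀))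
    {Ef : Functional (doubleCarriers C₀) E} {W : Set (ℕ → ℝ)} {Adm : Set (E → (doubleCarriers C₀).Dom → ℝ)}
    {T : ℕ → (ℕ → ℝ) → (E → (doubleCarriers C₀).Dom → ℝ) → ι → ℝ} {κ : ℝ} {wt : ℕ → ι → ℝ} {τ : ℕ → ℕ → ℝ}
    {τbar ω ωh : ℝ} {act : ℕ → ℝ → E → lp (fun _ : ι => ℂ) ∞ → G.P → ℂ}
    {actA : ℕ → ℝ → E → lp (fun _ : ι => ℂ) ∞ × ℂ → G.P → ℂ} {U₀ : E}
    {explZ : ℕ → E → (doubleCarriers C₀).Dom → ℝ}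
    (h0 : ∀ g ∈ W, ∀ (U : E) (X : (doubleCarriers C₀).Dom), (doubleCarriers C₀).scale X = 0 → Ef g U X = 0)
    (hAdm : AdmissibleTerms Ef W Adm) (hres : AdmRestrict Adm) (hadd : ChannelAdditive Adm T) (hloc : ChannelLocal Adm T)
    (hstep : ChannelSizeAtStepNN Adm T κ wt τ) (hfac : Factorises Ef W T (ΨOf G act wt U₀ explZ))
    (hsmul : ∀ (c : ℝ), ∀ H ∈ Adm, c • H ∈ Adm) (hne : Adm.Nonempty) (hwt : ∀ m y, 0 < wt m y)
    (hτ : ∀ k j, j ≤ k → 0 ≤ τ k j ∧ τ k j ≤ τbar * ω ^ (k - j)) (hτbar : 0 < τbar) (hω : 0 ≤ ω) (hωh : 0 < ωh)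
    (hωωh : ω ≤ ωh) {m : ℕ → ℝ → E → G.P → ℝ} {a d : G.P → ℝ} {δ : (doubleCarriers C₀).Dom → ℝ}
    {p₀ qT cd : ℕ → ℝ} {disp : ℕ → ℝ → ℝ → ℝ} {R₀ s₀ B pbar θ₀ θ cdbar qTbar : ℝ}
    (hs₀ : 0 < s₀) (hsR : s₀ < R₀) (hB : 0 ≤ B) (hpbar : 0 ≤ pbar) (hθ₀1 : θ₀ < 1) (hθ0 : 0 < θ) (hθ1 : θ < 1)
    (hKPA : G.PotentialKPG W actA m a d R₀)
    (hread : ∀ g ∈ W, ∀ g' ∈ W, ∀ (k : ℕ) (U : E) (X : (doubleCarriers C₀).Dom), (doubleCarriers C₀).scale X = k + 1 →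
      ∀ Q ∈ ball (0 : lp (fun _ : ι => ℂ) ∞) R₀, ∀ γ ∈ G.vol X,
        act k (g' k) U Q γ = actA k (g k) U (Q, ((disp k (g k) (g' k) : ℝ) : ℂ)) γ)
    (hdisp0 : ∀ (k : ℕ) (s : ℝ), disp k s s = 0)
    (hdispW : ∀ g ∈ W, ∀ g' ∈ W, ∀ k : ℕ, |disp k (g k) (g' k)| ≤ s₀)
    (hdispL : ∀ g ∈ W, ∀ g' ∈ W, ∀ k : ℕ, |disp k (g k) (g' k)| ≤ cd k * |g k - g' k|)
    (hcd0 : ∀ k, 0 ≤ cd k) (hcdb : ∀ k, cd k ≤ cdbar)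
    (hdec : G.DecayExtract δ d) (hpin : G.PinBudget a δ (fun _ => B) κ)
    (hexplZ : ∀ (k : ℕ) (U : E) (X : (doubleCarriers C₀).Dom), (doubleCarriers C₀).scale X = k + 1 →
      |explZ k U X| ≤ Real.exp (-(κ * (doubleCarriers C₀).d X)) * p₀ k)
    (hp₀ : ∀ k, p₀ k ≤ pbar) (hqTb : ∀ k, qT k ≤ qTbar)
    (hTcup : ∀ g ∈ W, ∀ g' ∈ W, ∀ (k : ℕ) (y : ι),
      |T k g (Ef g) y - T k g' (Ef g) y| ≤ wt k y * (qT k * |g k - g' k|))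
    (hroom₀ : ωh * s₀ + τbar * (2 * B + pbar) ≤ θ₀ * s₀) (hroom : ωh * R₀ + τbar * (2 * B + pbar) ≤ θ * R₀) :
    NE9 Ef W κ (prodModuli (1 / (1 - θ ^ 2) * (2 * B / (R₀ - s₀) * max cdbar qTbar)) fun _ => θ) ∧
      FadingMemory (1 / (1 - θ ^ 2) * (2 * B / (R₀ - s₀) * max cdbar qTbar) / θ) θ
        (prodModuli (1 / (1 - θ ^ 2) * (2 * B / (R₀ - s₀) * max cdbar qTbar)) fun _ => θ) :=
  ne9_and_fadingMemory_of_augmentedPencil_twoRadii_SP_vac G h0 hAdm hres hadd hloc hstep hfac hsmul hne hwt hτ hτbar hω hωh hωωh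
    hs₀ hsR hB hpbar hθ₀1 hθ0 hθ1 hKPA hread hdisp0 hdispW hdispL hcd0 hcdb hdec hpin
    (fun k s Q U X => psiOf_eq_vac G act wt U₀ explZ k s Q U X) hexplZ hp₀ hqTb hTcup hroom₀ hroom

end Record

end Summit.QuantumFields.BalabanUV.T4Continuum.NE9AugmentedPencilEnd

end
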